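import Mathlib
import HarnessLib
import Literature.Geometry.DiscreteGeometry.BondGraph
import Literature.Geometry.DiscreteGeometry.KissingPatterns
import Summits.AtomisticToContinuum.Crystallization.Theorems.PricedLinkCensusSoftLayerPropagationBasics
import Summits.AtomisticToContinuum.Crystallization.Theorems.PricedLinkCensusSoftLayerPropagationStubMetricChart
import Summits.AtomisticToContinuum.Crystallization.Theorems.DefectFreeCrystallizes.Negative.TypeGap

/-!
# Shadow development: gauge-fixed charts and handedness (crux `SoftLayerPropagation`, line `Sketch`, stub `develop_HO`)

Route `PricedLinkCensus`, crux `SoftLayerPropagation` (stmt-AtomisticToContinuum-14233), line `Sketch`.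
The registered stub `develop_HO` = hypothesis `HO` (handedness) of the development `develop_step`:
from the chart-existence hypothesis on the `8·nn_i`-ball one CHOOSES total chart functions
`Pc, Ac, mc` with the same specification on the ball and frame volume `det (Ac j e₀) (Ac j e₁) (Ac j e₂) = 1`
(GAUGE: a chart of frame volume `−1` is precomposed with the pattern's improper involutive symmetry —
`−id` for the FCC pattern, the reflection in the hexagonal plane `x + y + z = 0` for the tree's HCP
coordinates; `developHO_pattern_improper_symmetry`, `developHO_chart_gauge`), and then for every bond
`j ∼ k` in the ball and every contact tetrahedron `{j, k, a, b}` the label volume of `(k, a, b)` at `j`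
is MINUS the label volume of `(j, a, b)` at `k`: `metric_handedness_chart` (`δ = 1/20` covers the bond
windows `[1, 1+η]`, `[1/(1+η), (1+η)²]` at `η ≤ 1/100`) at both ends (`developHO_handedness_at`), the
re-basing identity `det (y j − y k) (y a − y k) (y b − y k) = − det (y k − y j) (y a − y j) (y b − y j)`
(`developHO_det3_rebase`), and `det² = 1/2` for exact unit contact triples (`det3_sq_eq_half_of_contact`).
All `[folklore]`; no new definitions.
-/

noncomputable section

namespace Summit.AtomisticToContinuum.Crystallization.Theorems

open Literature.Geometry.DiscreteGeometry
open RealInnerProductSpace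

/-! ### The improper symmetries of the two patterns -/

-- Central symmetry of the FCC pattern: `DefectFreeCrystallizes.Negative.TypeGap.neg_mem_fccKissingPattern` (tree).

/-- The mirror table of `hcpInt` in the plane `x + y + z = 0`: `3 w = 3 v − 2 (v₀+v₁+v₂) (1,1,1)`. [folklore] -/
theorem developHO_hcpInt_mirror : ∀ v ∈ hcpInt, ∃ w ∈ hcpInt, ∀ i : Fin 3,
    3 * w i = 3 * v i - 2 * (v 0 + v 1 + v 2) := by
  decide

/-- The reflection of `ℝ³` in the plane `x + y + z = 0`, in coordinates. [folklore] -/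
theorem developHO_mirror_apply (x : EuclideanSpace ℝ (Fin 3)) (i : Fin 3) :
    ((ℝ ∙ (intVec ![1, 1, 1] : EuclideanSpace ℝ (Fin 3)))ᗮ.reflection x) i =
      x i - 2 / 3 * (x 0 + x 1 + x 2) := by
  rw [Submodule.reflection_orthogonal_apply, Submodule.reflection_singleton_apply]
  have hn : ‖(intVec ![1, 1, 1] : EuclideanSpace ℝ (Fin 3))‖ ^ 2 = 3 := by
    rw [Literature.Algebra.EuclideanLattices.norm_sq_fin_three]; simp [intVec_apply]; norm_num
  have hi : ⟪(intVec ![1, 1, 1] : EuclideanSpace ℝ (Fin 3)), x⟫ = x 0 + x 1 + x 2 := by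
    rw [Literature.Algebra.EuclideanLattices.inner_fin_three]; simp [intVec_apply]
  simp only [RCLike.ofReal_real_eq_id, id, hn, hi, two_smul]
  fin_cases i <;> simp [intVec_apply] <;> ring

/-- The mirror has frame volume `−1`. [folklore] -/
theorem developHO_det3_frame_mirror :
    Matrix.det ![WithLp.ofLp (((ℝ ∙ (intVec ![1, 1, 1] : EuclideanSpace ℝ (Fin 3)))ᗮ.reflection)
        (EuclideanSpace.single 0 1)),
      WithLp.ofLp (((ℝ ∙ (intVec ![1, 1, 1] : EuclideanSpace ℝ (Fin 3)))ᗮ.reflection)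
        (EuclideanSpace.single 1 1)),
      WithLp.ofLp (((ℝ ∙ (intVec ![1, 1, 1] : EuclideanSpace ℝ (Fin 3)))ᗮ.reflection)
        (EuclideanSpace.single 2 1))] = -1 := by
  rw [det3_eq]
  simp [developHO_mirror_apply]
  norm_num

/-- The HCP pattern is symmetric in the hexagonal plane `x + y + z = 0`. [folklore] -/
theorem developHO_mirror_mem_hcpKissingPattern {p : EuclideanSpace ℝ (Fin 3)} (hp : p ∈ hcpKissingPattern) :
    (ℝ ∙ (intVec ![1, 1, 1] : EuclideanSpace ℝ (Fin 3)))ᗮ.reflection p ∈ hcpKissingPattern := by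
  obtain ⟨v, hv, rfl⟩ := Finset.mem_image.1 hp
  obtain ⟨w, hw, hvw⟩ := developHO_hcpInt_mirror v hv
  refine Finset.mem_image.2 ⟨w, hw, ?_⟩
  rw [map_smul]
  congr 1
  ext i
  rw [developHO_mirror_apply]
  simp only [intVec_apply]
  have h' : (3 : ℝ) * w i = 3 * v i - 2 * (v 0 + v 1 + v 2) := by exact_mod_cast hvw i
  linarith

/-- The two patterns have an improper involutive symmetry (`−id` for FCC, the hexagonal mirror for HCP). [folklore] -/
theorem developHO_pattern_improper_symmetry {P : Finset (EuclideanSpace ℝ (Fin 3))}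
    (hP : P = fccKissingPattern ∨ P = hcpKissingPattern) :
    ∃ σ : EuclideanSpace ℝ (Fin 3) ≃ₗᵢ[ℝ] EuclideanSpace ℝ (Fin 3),
      (∀ p ∈ P, σ p ∈ P) ∧ (∀ p, σ (σ p) = p) ∧
      Matrix.det ![WithLp.ofLp (σ (EuclideanSpace.single 0 1)), WithLp.ofLp (σ (EuclideanSpace.single 1 1)),
        WithLp.ofLp (σ (EuclideanSpace.single 2 1))] = -1 := by
  rcases hP with rfl | rfl
  · refine ⟨LinearIsometryEquiv.neg ℝ, fun p hp => ?_, fun p => ?_, ?_⟩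
    · simpa using DefectFreeCrystallizes.Negative.TypeGap.neg_mem_fccKissingPattern hp
    · simp
    · rw [det3_eq]
      simp
  · exact ⟨(ℝ ∙ (intVec ![1, 1, 1] : EuclideanSpace ℝ (Fin 3)))ᗮ.reflection,
      fun p hp => developHO_mirror_mem_hcpKissingPattern hp, fun p => Submodule.reflection_reflection _ p,
      developHO_det3_frame_mirror⟩

/-! ### Gauge fixing, bond windows, handedness at one end -/

/-- **Gauge fixing.**  A chart `(P, A, m)` at `j` can be replaced by one with the same pattern and
frame volume `+1`: if `c_A = −1`, precompose with the pattern's improper symmetry. [folklore] -/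
theorem developHO_chart_gauge {η : ℝ} {N : ℕ} {y : Fin N → EuclideanSpace ℝ (Fin 3)} {j : Fin N}
    {P : Finset (EuclideanSpace ℝ (Fin 3))}
    {A : EuclideanSpace ℝ (Fin 3) →ₗᵢ[ℝ] EuclideanSpace ℝ (Fin 3)} {m : EuclideanSpace ℝ (Fin 3) → Fin N}
    (hP : P = fccKissingPattern ∨ P = hcpKissingPattern)
    (h1 : ∀ p ∈ P, (bondGraph η y).Adj j (m p) ∧
      dist (y (m p)) (y j + nearestDist y j • A p) ≤ nearestDist y j / 4)
    (h2 : ∀ p ∈ P, ∀ q ∈ P, m p = m q → p = q)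
    (h3 : ∀ p ∈ P, ∀ q ∈ P, ((bondGraph η y).Adj (m p) (m q) ↔ dist p q = 1))
    (h4 : ∀ l, (bondGraph η y).Adj j l → ∃ p ∈ P, m p = l) :
    ∃ (A' : EuclideanSpace ℝ (Fin 3) →ₗᵢ[ℝ] EuclideanSpace ℝ (Fin 3)) (m' : EuclideanSpace ℝ (Fin 3) → Fin N),
      ((P = fccKissingPattern ∨ P = hcpKissingPattern) ∧
        (∀ p ∈ P, (bondGraph η y).Adj j (m' p) ∧
          dist (y (m' p)) (y j + nearestDist y j • A' p) ≤ nearestDist y j / 4) ∧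
        (∀ p ∈ P, ∀ q ∈ P, m' p = m' q → p = q) ∧
        (∀ p ∈ P, ∀ q ∈ P, ((bondGraph η y).Adj (m' p) (m' q) ↔ dist p q = 1)) ∧
        (∀ l, (bondGraph η y).Adj j l → ∃ p ∈ P, m' p = l)) ∧
      Matrix.det ![WithLp.ofLp (A' (EuclideanSpace.single 0 1)), WithLp.ofLp (A' (EuclideanSpace.single 1 1)),
        WithLp.ofLp (A' (EuclideanSpace.single 2 1))] = 1 := by
  rcases det3_frame_eq_one_or A with hc | hc
  · exact ⟨A, m, ⟨hP, h1, h2, h3, h4⟩, hc⟩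
  obtain ⟨σ, hσP, hσσ, hσc⟩ := developHO_pattern_improper_symmetry hP
  refine ⟨A.comp σ.toLinearIsometry, m ∘ σ, ⟨hP, ?_, ?_, ?_, ?_⟩, ?_⟩
  · intro p hp
    simpa using h1 (σ p) (hσP p hp)
  · intro p hp q hq hpq
    have e := h2 (σ p) (hσP p hp) (σ q) (hσP q hq) hpq
    rw [← hσσ p, e, hσσ]
  · intro p hp q hq
    rw [Function.comp_apply, Function.comp_apply, h3 (σ p) (hσP p hp) (σ q) (hσP q hq), σ.dist_map]
  · intro l hl
    obtain ⟨p, hp, rfl⟩ := h4 l hl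
    exact ⟨σ p, hσP p hp, by simp [hσσ]⟩
  · have e := det3_linearMap A.toLinearMap (σ (EuclideanSpace.single 0 1)) (σ (EuclideanSpace.single 1 1))
      (σ (EuclideanSpace.single 2 1))
    simp only [LinearIsometry.coe_toLinearMap] at e
    simp only [LinearIsometry.coe_comp, Function.comp_apply, LinearIsometryEquiv.coe_toLinearIsometry]
    rw [e, hc, hσc]; norm_num

/-- Bond window: for a bond `j ∼ k`, `nn_j ≤ dist (y j) (y k) ≤ (1 + η) nn_j`. [folklore] -/
theorem developHO_bond_window {η : ℝ} (hη : 0 ≤ η) {N : ℕ} {y : Fin N → EuclideanSpace ℝ (Fin 3)} {j k : Fin N}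
    (h : (bondGraph η y).Adj j k) :
    nearestDist y j ≤ dist (y j) (y k) ∧ dist (y j) (y k) ≤ (1 + η) * nearestDist y j := by
  obtain ⟨hne, hle⟩ := bondGraph_adj.1 h
  exact ⟨nearestDist_le_dist y hne.symm,
    hle.trans (mul_le_mul_of_nonneg_left (min_le_left _ _) (by linarith))⟩

/-- Link-edge window: for `j ∼ k` and `k ∼ a`, `nn_j ≤ (1 + η) dist (y k) (y a)` and
`dist (y k) (y a) ≤ (1 + η)² nn_j`. [folklore] -/
theorem developHO_link_window {η : ℝ} (hη : 0 ≤ η) {N : ℕ} {y : Fin N → EuclideanSpace ℝ (Fin 3)} {j k a : Fin N}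
    (hjk : (bondGraph η y).Adj j k) (hka : (bondGraph η y).Adj k a) :
    nearestDist y j ≤ (1 + η) * dist (y k) (y a) ∧ dist (y k) (y a) ≤ (1 + η) ^ 2 * nearestDist y j := by
  obtain ⟨h1, h2⟩ := developHO_bond_window hη hka
  have h3 : nearestDist y j ≤ (1 + η) * nearestDist y k := nearestDist_le_mul_of_adj (by linarith) hjk
  have h4 : nearestDist y k ≤ (1 + η) * nearestDist y j := nearestDist_le_mul_of_adj (by linarith) hjk.symm
  constructor
  · exact h3.trans (mul_le_mul_of_nonneg_left h1 (by linarith))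
  · calc dist (y k) (y a) ≤ (1 + η) * nearestDist y k := h2
      _ ≤ (1 + η) * ((1 + η) * nearestDist y j) := mul_le_mul_of_nonneg_left h4 (by linarith)
      _ = (1 + η) ^ 2 * nearestDist y j := by ring

/-- **Handedness at one end of a bond.**  At a site `j` with positive scale and a gauge-fixed chart
`A` (frame volume `1`), for a contact tetrahedron `{j, k, a, b}` whose labels `p₁ p₂ p₃` (of
`k, a, b`) form an exact unit contact triple `nn_j/4`-close (after scaling) to the real bond vectors,
the label volume `det p₁ p₂ p₃` has the sign of the real volume `det (y k − y j) (y a − y j) (y b − y j)`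
(`metric_handedness_chart` with `δ = 1/20`). [folklore] -/
theorem developHO_handedness_at {η : ℝ} (hη0 : 0 < η) (hη1 : η ≤ 1 / 100) {N : ℕ}
    {y : Fin N → EuclideanSpace ℝ (Fin 3)} {j k a b : Fin N} (hν : 0 < nearestDist y j)
    (hjk : (bondGraph η y).Adj j k) (hja : (bondGraph η y).Adj j a) (hjb : (bondGraph η y).Adj j b)
    (hka : (bondGraph η y).Adj k a) (hkb : (bondGraph η y).Adj k b) (hab : (bondGraph η y).Adj a b)
    (A : EuclideanSpace ℝ (Fin 3) →ₗᵢ[ℝ] EuclideanSpace ℝ (Fin 3))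
    (hA : Matrix.det ![WithLp.ofLp (A (EuclideanSpace.single 0 1)), WithLp.ofLp (A (EuclideanSpace.single 1 1)),
        WithLp.ofLp (A (EuclideanSpace.single 2 1))] = 1)
    {p₁ p₂ p₃ : EuclideanSpace ℝ (Fin 3)} (n₁ : ‖p₁‖ = 1) (n₂ : ‖p₂‖ = 1) (n₃ : ‖p₃‖ = 1)
    (d₁₂ : ‖p₁ - p₂‖ = 1) (d₁₃ : ‖p₁ - p₃‖ = 1) (d₂₃ : ‖p₂ - p₃‖ = 1)
    (c₁ : dist (y k) (y j + nearestDist y j • A p₁) ≤ nearestDist y j / 4)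
    (c₂ : dist (y a) (y j + nearestDist y j • A p₂) ≤ nearestDist y j / 4)
    (c₃ : dist (y b) (y j + nearestDist y j • A p₃) ≤ nearestDist y j / 4) :
    0 < Matrix.det ![WithLp.ofLp p₁, WithLp.ofLp p₂, WithLp.ofLp p₃] *
      Matrix.det ![WithLp.ofLp (y k - y j), WithLp.ofLp (y a - y j), WithLp.ofLp (y b - y j)] := by
  set ν := nearestDist y j with hν_def
  -- bounds of `‖ν⁻¹ • x‖` from the weak window `ν ≤ (1+η)‖x‖`, `‖x‖ ≤ (1+η)² ν`
  have key : ∀ x : EuclideanSpace ℝ (Fin 3), ν ≤ (1 + η) * ‖x‖ → ‖x‖ ≤ (1 + η) ^ 2 * ν →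
      1 - 1 / 20 ≤ ‖ν⁻¹ • x‖ ∧ ‖ν⁻¹ • x‖ ≤ 1 + 1 / 20 := by
    intro x hlo hhi
    rw [norm_smul, norm_inv, Real.norm_of_nonneg hν.le]
    have hsq : (1 + η) ^ 2 ≤ 10201 / 10000 := by nlinarith
    have hhi' : ‖x‖ ≤ 10201 / 10000 * ν := hhi.trans (mul_le_mul_of_nonneg_right hsq hν.le)
    have hlo' : ν ≤ 101 / 100 * ‖x‖ :=
      hlo.trans (mul_le_mul_of_nonneg_right (by linarith) (norm_nonneg x))
    constructor
    · rw [le_inv_mul_iff₀ hν]; linarith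
    · rw [inv_mul_le_iff₀ hν]; linarith
  -- bond vectors: window `ν ≤ d ≤ (1+η) ν`, weakened
  have keyb : ∀ {l : Fin N}, (bondGraph η y).Adj j l →
      1 - 1 / 20 ≤ ‖ν⁻¹ • (y l - y j)‖ ∧ ‖ν⁻¹ • (y l - y j)‖ ≤ 1 + 1 / 20 := by
    intro l hl
    obtain ⟨h1, h2⟩ := developHO_bond_window hη0.le hl
    have hn : ‖y l - y j‖ = dist (y j) (y l) := by rw [← dist_eq_norm, dist_comm]
    refine key _ ?_ ?_
    · rw [hn]; nlinarith [dist_nonneg (x := y j) (y := y l)]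
    · rw [hn]; nlinarith
  -- link edges: window `ν ≤ (1+η) d`, `d ≤ (1+η)² ν`
  have keyl : ∀ {l l' : Fin N}, (bondGraph η y).Adj j l → (bondGraph η y).Adj l l' →
      1 - 1 / 20 ≤ ‖ν⁻¹ • (y l - y j) - ν⁻¹ • (y l' - y j)‖ ∧
        ‖ν⁻¹ • (y l - y j) - ν⁻¹ • (y l' - y j)‖ ≤ 1 + 1 / 20 := by
    intro l l' hl hll'
    obtain ⟨h1, h2⟩ := developHO_link_window hη0.le hl hll'
    have he : ν⁻¹ • (y l - y j) - ν⁻¹ • (y l' - y j) = ν⁻¹ • (y l - y l') := by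
      rw [← smul_sub]; congr 1; abel
    have hn : ‖y l - y l'‖ = dist (y l) (y l') := by rw [← dist_eq_norm]
    rw [he]
    refine key _ ?_ ?_
    · rw [hn]; exact h1
    · rw [hn]; exact h2
  -- closeness
  have keyc : ∀ (x q : EuclideanSpace ℝ (Fin 3)), dist x (y j + ν • A q) ≤ ν / 4 →
      ‖ν⁻¹ • (x - y j) - A q‖ ≤ 1 / 4 := by
    intro x q h
    have e : ν⁻¹ • (x - y j) - A q = ν⁻¹ • (x - (y j + ν • A q)) := by
      rw [← sub_sub, smul_sub ν⁻¹ (x - y j) (ν • A q), smul_smul, inv_mul_cancel₀ hν.ne', one_smul]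
    rw [e, norm_smul, norm_inv, Real.norm_of_nonneg hν.le, ← dist_eq_norm, inv_mul_le_iff₀ hν]
    linarith
  obtain ⟨m₁, m₁'⟩ := keyb hjk
  obtain ⟨m₂, m₂'⟩ := keyb hja
  obtain ⟨m₃, m₃'⟩ := keyb hjb
  obtain ⟨e₁₂, e₁₂'⟩ := keyl hjk hka
  obtain ⟨e₁₃, e₁₃'⟩ := keyl hjk hkb
  obtain ⟨e₂₃, e₂₃'⟩ := keyl hja hab
  have h := metric_handedness_chart (δ := 1 / 20) (by norm_num) (by norm_num) A hA p₁ p₂ p₃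
    (ν⁻¹ • (y k - y j)) (ν⁻¹ • (y a - y j)) (ν⁻¹ • (y b - y j)) n₁ n₂ n₃ d₁₂ d₁₃ d₂₃
    m₁ m₁' m₂ m₂' m₃ m₃' e₁₂ e₁₂' e₁₃ e₁₃' e₂₃ e₂₃' (keyc _ _ c₁) (keyc _ _ c₂) (keyc _ _ c₃)
  rw [det3_smul] at h
  have h3 : 0 < ν⁻¹ ^ 3 := by positivity
  have h' : 0 < ν⁻¹ ^ 3 * (Matrix.det ![WithLp.ofLp p₁, WithLp.ofLp p₂, WithLp.ofLp p₃] *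
      Matrix.det ![WithLp.ofLp (y k - y j), WithLp.ofLp (y a - y j), WithLp.ofLp (y b - y j)]) := by
    linarith [h]
  exact pos_of_mul_pos_right h' h3.le

/-- Re-basing the real contact tetrahedron at the other end of the bond flips the signed volume:
`det (z − u) (v − u) (w − u) = − det (u − z) (v − z) (w − z)`. [folklore] -/
theorem developHO_det3_rebase (u v w : EuclideanSpace ℝ (Fin 3)) (z : EuclideanSpace ℝ (Fin 3)) :
    Matrix.det ![WithLp.ofLp (z - u), WithLp.ofLp (v - u), WithLp.ofLp (w - u)] =
      - Matrix.det ![WithLp.ofLp (u - z), WithLp.ofLp (v - z), WithLp.ofLp (w - z)] := by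
  simp only [det3_eq, PiLp.sub_apply]
  ring

/-! ### The registered stub -/

/-- **`develop_HO` (registered stub of line `Sketch`; hypothesis `HO` of `develop_step`): gauge-fixed
charts and handedness.**  From the chart-existence hypothesis on the `8·nn_i`-ball, total chart
functions `Pc, Ac, mc` with the same specification on the ball (chosen gauge-fixed: frame volume `+1`,
`developHO_chart_gauge`) such that for every bond `j ∼ k` of sites of the ball and every contact
tetrahedron `{j, k, a, b}` the signed volume of the labels of `(k, a, b)` at `j` is minus that of the
labels of `(j, a, b)` at `k` (`developHO_handedness_at` at both ends, `developHO_det3_rebase`,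
`det3_sq_eq_half_of_contact`). [folklore] -/
theorem develop_HO :
    ∀ η : ℝ, 0 < η → η ≤ 1 / 100 →
      ∀ (N : ℕ) (y : Fin N → EuclideanSpace ℝ (Fin 3)) (i : Fin N),
        0 < Literature.Geometry.DiscreteGeometry.nearestDist y i →
        (∀ j : Fin N, dist (y i) (y j) ≤ 8 * Literature.Geometry.DiscreteGeometry.nearestDist y i →
          Literature.Geometry.DiscreteGeometry.IsChargeFree η y j) →
        (∀ j : Fin N, dist (y i) (y j) ≤ 8 * Literature.Geometry.DiscreteGeometry.nearestDist y i →
          ∃ (P : Finset (EuclideanSpace ℝ (Fin 3)))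
            (A : EuclideanSpace ℝ (Fin 3) →ₗᵢ[ℝ] EuclideanSpace ℝ (Fin 3))
            (m : EuclideanSpace ℝ (Fin 3) → Fin N),
            (P = Literature.Geometry.DiscreteGeometry.fccKissingPattern ∨
              P = Literature.Geometry.DiscreteGeometry.hcpKissingPattern) ∧
            (∀ p ∈ P, (Literature.Geometry.DiscreteGeometry.bondGraph η y).Adj j (m p) ∧
              dist (y (m p)) (y j + Literature.Geometry.DiscreteGeometry.nearestDist y j • A p) ≤
                Literature.Geometry.DiscreteGeometry.nearestDist y j / 4) ∧
            (∀ p ∈ P, ∀ q ∈ P, m p = m q → p = q) ∧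
            (∀ p ∈ P, ∀ q ∈ P,
              ((Literature.Geometry.DiscreteGeometry.bondGraph η y).Adj (m p) (m q) ↔ dist p q = 1)) ∧
            (∀ l, (Literature.Geometry.DiscreteGeometry.bondGraph η y).Adj j l → ∃ p ∈ P, m p = l)) →
        ∃ (Pc : Fin N → Finset (EuclideanSpace ℝ (Fin 3)))
          (Ac : Fin N → EuclideanSpace ℝ (Fin 3) →ₗᵢ[ℝ] EuclideanSpace ℝ (Fin 3))
          (mc : Fin N → EuclideanSpace ℝ (Fin 3) → Fin N),
          (∀ j : Fin N, dist (y i) (y j) ≤ 8 * Literature.Geometry.DiscreteGeometry.nearestDist y i →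
            (Pc j = Literature.Geometry.DiscreteGeometry.fccKissingPattern ∨
              Pc j = Literature.Geometry.DiscreteGeometry.hcpKissingPattern) ∧
            (∀ p ∈ Pc j, (Literature.Geometry.DiscreteGeometry.bondGraph η y).Adj j (mc j p) ∧
              dist (y (mc j p)) (y j + Literature.Geometry.DiscreteGeometry.nearestDist y j • Ac j p) ≤
                Literature.Geometry.DiscreteGeometry.nearestDist y j / 4) ∧
            (∀ p ∈ Pc j, ∀ q ∈ Pc j, mc j p = mc j q → p = q) ∧
            (∀ p ∈ Pc j, ∀ q ∈ Pc j,
              ((Literature.Geometry.DiscreteGeometry.bondGraph η y).Adj (mc j p) (mc j q) ↔ dist p q = 1)) ∧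
            (∀ l, (Literature.Geometry.DiscreteGeometry.bondGraph η y).Adj j l → ∃ p ∈ Pc j, mc j p = l)) ∧
          (∀ j k : Fin N, dist (y i) (y j) ≤ 8 * Literature.Geometry.DiscreteGeometry.nearestDist y i →
            dist (y i) (y k) ≤ 8 * Literature.Geometry.DiscreteGeometry.nearestDist y i → (Literature.Geometry.DiscreteGeometry.bondGraph η y).Adj j k →
            ∀ a b : Fin N, (Literature.Geometry.DiscreteGeometry.bondGraph η y).Adj j a → (Literature.Geometry.DiscreteGeometry.bondGraph η y).Adj j b → (Literature.Geometry.DiscreteGeometry.bondGraph η y).Adj k a → (Literature.Geometry.DiscreteGeometry.bondGraph η y).Adj k b → (Literature.Geometry.DiscreteGeometry.bondGraph η y).Adj a b →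
            ∀ p₁ ∈ Pc j, ∀ p₂ ∈ Pc j, ∀ p₃ ∈ Pc j, mc j p₁ = k → mc j p₂ = a → mc j p₃ = b →
            ∀ q₁ ∈ Pc k, ∀ q₂ ∈ Pc k, ∀ q₃ ∈ Pc k, mc k q₁ = j → mc k q₂ = a → mc k q₃ = b →
            Matrix.det ![WithLp.ofLp p₁, WithLp.ofLp p₂, WithLp.ofLp p₃] =
              - Matrix.det ![WithLp.ofLp q₁, WithLp.ofLp q₂, WithLp.ofLp q₃]) := by
  intro η hη0 hη1 N y i _hnn hCF hCh
  -- gauge-fixed charts on the ball (junk elsewhere)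
  have hG : ∀ j : Fin N, ∃ (P : Finset (EuclideanSpace ℝ (Fin 3)))
      (A : EuclideanSpace ℝ (Fin 3) →ₗᵢ[ℝ] EuclideanSpace ℝ (Fin 3)) (m : EuclideanSpace ℝ (Fin 3) → Fin N),
      dist (y i) (y j) ≤ 8 * nearestDist y i →
        ((P = fccKissingPattern ∨ P = hcpKissingPattern) ∧
          (∀ p ∈ P, (bondGraph η y).Adj j (m p) ∧
            dist (y (m p)) (y j + nearestDist y j • A p) ≤ nearestDist y j / 4) ∧
          (∀ p ∈ P, ∀ q ∈ P, m p = m q → p = q) ∧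
          (∀ p ∈ P, ∀ q ∈ P, ((bondGraph η y).Adj (m p) (m q) ↔ dist p q = 1)) ∧
          (∀ l, (bondGraph η y).Adj j l → ∃ p ∈ P, m p = l)) ∧
        Matrix.det ![WithLp.ofLp (A (EuclideanSpace.single 0 1)), WithLp.ofLp (A (EuclideanSpace.single 1 1)),
          WithLp.ofLp (A (EuclideanSpace.single 2 1))] = 1 := by
    intro j
    by_cases hj : dist (y i) (y j) ≤ 8 * nearestDist y i
    · obtain ⟨P, A, m, hP, h1, h2, h3, h4⟩ := hCh j hj
      obtain ⟨A', m', h⟩ := developHO_chart_gauge hP h1 h2 h3 h4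
      exact ⟨P, A', m', fun _ => h⟩
    · exact ⟨∅, LinearIsometry.id, fun _ => j, fun h => absurd h hj⟩
  choose Pc Ac mc hspec using hG
  refine ⟨Pc, Ac, mc, fun j hj => (hspec j hj).1, ?_⟩
  intro j k hj hk hjk a b hja hjb hka hkb hab p₁ hp₁ p₂ hp₂ p₃ hp₃ e₁ e₂ e₃ q₁ hq₁ q₂ hq₂ q₃ hq₃ f₁ f₂ f₃
  obtain ⟨⟨hP, hcl, -, hiff, -⟩, hcA⟩ := hspec j hj
  obtain ⟨⟨hP', hcl', -, hiff', -⟩, hcA'⟩ := hspec k hk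
  have hνj : 0 < nearestDist y j := nearestDist_pos_of_isChargeFree (hCF j hj)
  have hνk : 0 < nearestDist y k := nearestDist_pos_of_isChargeFree (hCF k hk)
  -- pattern points are unit vectors; unit label distances are unit norms
  have hn : ∀ {P : Finset (EuclideanSpace ℝ (Fin 3))} {p : EuclideanSpace ℝ (Fin 3)},
      (P = fccKissingPattern ∨ P = hcpKissingPattern) → p ∈ P → ‖p‖ = 1 := by
    rintro P p (rfl | rfl) hp
    · exact norm_eq_one_of_mem_fccKissingPattern hp
    · exact norm_eq_one_of_mem_hcpKissingPattern hp
  have hd : ∀ {p q : EuclideanSpace ℝ (Fin 3)}, dist p q = 1 → ‖p - q‖ = 1 := fun h => by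
    rwa [← dist_eq_norm]
  -- the labels of the contact tetrahedron are exact unit contact triples
  -- (bonds `k∼a`, `k∼b`, `a∼b` read at `j`; `j∼a`, `j∼b`, `a∼b` read at `k`)
  have d₁₂ : dist p₁ p₂ = 1 := (hiff p₁ hp₁ p₂ hp₂).1 (by rw [e₁, e₂]; exact hka)
  have d₁₃ : dist p₁ p₃ = 1 := (hiff p₁ hp₁ p₃ hp₃).1 (by rw [e₁, e₃]; exact hkb)
  have d₂₃ : dist p₂ p₃ = 1 := (hiff p₂ hp₂ p₃ hp₃).1 (by rw [e₂, e₃]; exact hab)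
  have d'₁₂ : dist q₁ q₂ = 1 := (hiff' q₁ hq₁ q₂ hq₂).1 (by rw [f₁, f₂]; exact hja)
  have d'₁₃ : dist q₁ q₃ = 1 := (hiff' q₁ hq₁ q₃ hq₃).1 (by rw [f₁, f₃]; exact hjb)
  have d'₂₃ : dist q₂ q₃ = 1 := (hiff' q₂ hq₂ q₃ hq₃).1 (by rw [f₂, f₃]; exact hab)
  -- closeness of the real neighbours to the chart points
  have c₁ := (hcl p₁ hp₁).2
  have c₂ := (hcl p₂ hp₂).2
  have c₃ := (hcl p₃ hp₃).2
  have c'₁ := (hcl' q₁ hq₁).2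
  have c'₂ := (hcl' q₂ hq₂).2
  have c'₃ := (hcl' q₃ hq₃).2
  rw [e₁] at c₁; rw [e₂] at c₂; rw [e₃] at c₃; rw [f₁] at c'₁; rw [f₂] at c'₂; rw [f₃] at c'₃
  -- handedness at both ends
  have H1 := developHO_handedness_at hη0 hη1 hνj hjk hja hjb hka hkb hab (Ac j) hcA (hn hP hp₁) (hn hP hp₂)
    (hn hP hp₃) (hd d₁₂) (hd d₁₃) (hd d₂₃) c₁ c₂ c₃
  have H2 := developHO_handedness_at hη0 hη1 hνk hjk.symm hka hkb hja hjb hab (Ac k) hcA' (hn hP' hq₁)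
    (hn hP' hq₂) (hn hP' hq₃) (hd d'₁₂) (hd d'₁₃) (hd d'₂₃) c'₁ c'₂ c'₃
  rw [developHO_det3_rebase (y k) (y a) (y b) (y j)] at H2
  -- `det p² = det q² = 1/2` and opposite signs
  have sp := det3_sq_eq_half_of_contact p₁ p₂ p₃ (hn hP hp₁) (hn hP hp₂) (hn hP hp₃) (hd d₁₂) (hd d₁₃) (hd d₂₃)
  have sq := det3_sq_eq_half_of_contact q₁ q₂ q₃ (hn hP' hq₁) (hn hP' hq₂) (hn hP' hq₃) (hd d'₁₂) (hd d'₁₃)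
    (hd d'₂₃)
  set X := Matrix.det ![WithLp.ofLp p₁, WithLp.ofLp p₂, WithLp.ofLp p₃]
  set Y := Matrix.det ![WithLp.ofLp q₁, WithLp.ofLp q₂, WithLp.ofLp q₃]
  set D := Matrix.det ![WithLp.ofLp (y k - y j), WithLp.ofLp (y a - y j), WithLp.ofLp (y b - y j)]
  have hXY : X * Y < 0 := by nlinarith [sq_nonneg D]
  have hf : (X + Y) * (X - Y) = 0 := by linear_combination sp - sq
  rcases mul_eq_zero.1 hf with h | h
  · linarith
  · rw [sub_eq_zero] at h
    rw [h] at hXY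
    nlinarith [mul_self_nonneg Y]

end Summit.AtomisticToContinuum.Crystallization.Theorems

end
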